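import Summits.NavierStokesRegularity.FluidComputer.PalasekTowerRescaledCopy

/-!
# REGISTER v2.3′: the rescaled-copy alphabet — what line `fc-oneshot` adds to the split, in the kernel

Cell `ns-blowup`, seat `ns-blowup-fc-prover-3` (g0); companion of `PalasekTowerRescaledCopy.lean` (the
vocabulary `RescaledCopy` / `Runs` / `Letter` and the open statements `Capture` / `CaptureAt k` /
`Renormalise` / `FirstGateCopy` of the active line `fc-oneshot` v2.2 on the crux `EpisodeInduction`,
item stmt-NavierStokesRegularity-19178), of `PalasekTowerRegisterGlobalHeredity.lean` (p415576:
`HeredityAtOne` = item -19249, `HeredityFrom 2` = item -19250, the lossless split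
`EpisodeInductionG ↔ HeredityAtOne ∧ HeredityFrom 2`), of `PalasekTowerRegisterGlobalMargin.lean`
(p420640: `Margins.withDesign`, `HeredityAtGM`, `EpisodeInductionGM`, the designed closer
`navierStokesBreakdownR3_of_designed`) and of `PalasekTowerRegisterGlobalHalves.lean` (p419350:
silent-window uniqueness `Stage.continuation_velocity_eq`, no W14). LABEL: E–C typing (KERNEL
bookkeeping; every implication proved; the open statements appear only as hypotheses or inside
equivalences). WHAT THIS IS NOT: not Navier–Stokes evidence — no stage, letter, tower, design instance
or blow-up is constructed or asserted; nothing here proves or refutes a stub of the line.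

## What is proved (all at unit viscosity on the wide-base register, as the items are)

* §1 **`Renormalise` IS heredity IN the copy design at the generic levels**:
  `Renormalise ↔ ∀ k ≥ 2, HeredityAtGM (withDesign CopyDesign (routeG wide)) k`
  (`renormalise_iff_heredityAtGM_copyDesign`; ⇒ uses silent-window uniqueness to identify the gate's
  continuation with the extension stage it generates); `FirstGateCopy ↔ HeredityAtGM (withDesign …) 1`;
  the designed base is the base (`episodeBaseGM_copyDesign_iff`, the design is empty below level `2`);
  hence `EpisodeInductionGM (withDesign CopyDesign (routeG wide)) ↔ FirstGateCopy ∧ Renormalise` and the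
  honest `∃ design` route of planner RULING l.1890 (1) for THIS design, by name:
  `EpisodeBaseG → FirstGateCopy → Renormalise → W14 → NavierStokesBreakdownR3`
  (`navierStokesBreakdownR3_of_firstGateCopy_renormalise`) — Fefferman's (C) from the line WITHOUT the
  stub `Capture`.
* §2 **The line is LOSSLESS modulo `Capture`**: `Capture → Renormalise → HeredityFrom 2`,
  `HeredityFrom 2 → Capture → Renormalise`, so `Capture → (Renormalise ↔ HeredityFrom 2)` and
  `Capture → (EpisodeInductionG ↔ HeredityAtOne ∧ Renormalise)`: given alphabet closure, the gate stub
  IS the child crux `HeredityFromTwo`, and the line's whole content beyond the tenure split is `Capture`.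
* §3 **PROPAGATION — `Capture` reduces to its first instance, given the gate**:
  `Renormalise → CaptureAt k → CaptureAt (k + 1)` for `k ≥ 2` (`CaptureAt.succ`), hence
  `Renormalise → (Capture ↔ CaptureAt 2)`. Proof: restrict a level-`(k+1)` stage to level `k`, feed the
  gate, and identify the gate's continuation with the stage itself by silent-window uniqueness
  (`Stage.continuation_velocity_eq`: quiet schedule, `k ≥ 2`, finite energy, Tao 2013 Cor. 11.4
  UNFORCED + Lemma 8.1 — tree theorems, no named fact); the copy clause of the gate's output is then a
  clause of the stage. So the registered stub set {`stub_heredityAtOne`, `stub_capture`,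
  `stub_renormalise`} closes the crux already with `stub_capture` weakened to `CaptureAt 2`
  (`episodeInductionG_of_heredityAtOne_captureAtTwo_renormalise`).
* §4 **The `k = 1` corner** (forced stretch `[0, τ₁)` inside the comparison window, so Tao's forced
  Cor. 11.4 `tao_unconditional_uniqueness_velocity_forced` — the route's support item W14 through
  `.schwartzForce` — is the transfer lemma): `FirstGateCopy → W14 → CaptureAt 2`, and conversely
  `HeredityAtOne → CaptureAt 2 → FirstGateCopy` (no W14); hence, given W14,
  `EpisodeInductionG ∧ Capture ↔ FirstGateCopy ∧ Renormalise` and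
  `FirstGateCopy → Renormalise → W14 → EpisodeInductionG`: modulo the route's own uniqueness item the
  two statements {`FirstGateCopy`, `Renormalise`} close the crux ITEM as well, not only (C).

References: T. Tao, J. Amer. Math. Soc. 29 (2016) 601–674, §1.3 [cite: Tao2016AveragedNS, §1.3];
T. Tao, Anal. PDE 6 (2013) 25–107, Cor. 11.4, Lemma 8.1 [cite: Tao2011, Cor. 11.4]; S. Palasek,
arXiv:2605.13827 §4 [cite: Palasek2026ElementaryModel, §4]; C. L. Fefferman, Clay problem description,
(C) [cite: FeffermanClay2006, (C)].
-/

noncomputable section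

namespace Summit.NavierStokesRegularity.FluidComputer.PalasekTowerClayBridge

open Set MeasureTheory Filter Topology Function Real
open scoped ENNReal ContDiff NNReal
open Literature.Analysis.FluidPDE

/-! ## §1 `Renormalise` is heredity in the copy design; the designed route to (C) without `Capture` -/

/-- **The gate stub is designed heredity at the generic levels.** `Renormalise` holds iff, for every
`k ≥ 2`, every registered stage at level `k` IN the copy design extends to one at level `k + 1` IN the
copy design (`HeredityAtGM (withDesign CopyDesign (routeG wide)) k`, p420640 unbundled by
`heredityAtGM_withDesign_iff`). (⇒) the gate's continuation RUNS and carries the next LETTER, so it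
generates an extension stage (`Stage.nonempty_extends_of_continuation`), whose velocity agrees with the
continuation on `[0, τ (k+1)]` by silent-window uniqueness (quiet schedule, `k ≥ 2`), so the output
copy clause is the design clause of the extension; (⇐) the extension stage's own fields run, its
readout is a letter, and its design clause is the output copy. [folklore] -/
theorem renormalise_iff_heredityAtGM_copyDesign :
    Renormalise ↔ ∀ k, 2 ≤ k →
      HeredityAtGM (Margins.withDesign CopyDesign (Margins.routeG TowerRates.wide)) k := by
  constructor
  · intro h k hk
    rw [heredityAtGM_withDesign_iff]
    intro S hP hR hQ s hD
    obtain ⟨u, p, ⟨hcl, hagree, henergy, hceil⟩, ⟨hfloor, hstrain, hcore⟩, hcopy⟩ :=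
      h S hP hR hQ k hk s (hD hk)
    obtain ⟨s', hs'⟩ :=
      s.nonempty_extends_of_continuation hR hcl hagree henergy hceil hfloor hstrain hcore
    have heq : ∀ t ∈ Icc 0 (S.τ (k + 1)), u t = s'.u t :=
      s.continuation_velocity_eq one_pos hQ hk (S.τ_mono (Nat.le_succ k)) hcl s'.classical
        (fun t ht => (hagree t ht).1) (fun t ht => (hs' t ht).1) henergy s'.energy
    refine ⟨s', hs', fun _ => ?_⟩
    rw [Nat.add_sub_cancel, (hs' (S.τ k) ⟨(S.τ_pos k).le, le_rfl⟩).1,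
      ← heq (S.τ (k + 1)) ⟨(S.τ_pos _).le, le_rfl⟩]
    exact hcopy
  · intro h S hP hR hQ k hk s hcopy
    obtain ⟨s', hs', hD'⟩ :=
      (heredityAtGM_withDesign_iff _ _ k).1 (h k hk) S hP hR hQ s (fun _ => hcopy)
    refine ⟨s'.u, s'.p, Runs.of_extends s s' hs', Letter.of_stage s' le_rfl, ?_⟩
    have hc := hD' (le_trans hk (Nat.le_succ k))
    rw [Nat.add_sub_cancel, (hs' (S.τ k) ⟨(S.τ_pos k).le, le_rfl⟩).1] at hc
    exact hc

/-- **The first gate with copy output is designed heredity at level `1`** (the design has no clause at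
level `1`, and its level-`2` clause for the extension is the output copy, read through the agreement
at `τ 1`). [folklore] -/
theorem firstGateCopy_iff_heredityAtGM_copyDesign :
    FirstGateCopy ↔ HeredityAtGM (Margins.withDesign CopyDesign (Margins.routeG TowerRates.wide)) 1 := by
  rw [heredityAtGM_withDesign_iff]
  constructor
  · intro h S hP hR hQ s _
    obtain ⟨s', hs', hc⟩ := h S hP hR hQ s
    refine ⟨s', hs', fun _ => ?_⟩
    show RescaledCopy S 1 2 (s'.u (S.τ 1)) (s'.u (S.τ 2)) (2 / 3)
    rw [(hs' (S.τ 1) ⟨(S.τ_pos 1).le, le_rfl⟩).1]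
    exact hc
  · intro h S hP hR hQ s
    obtain ⟨s', hs', hD'⟩ := h S hP hR hQ s (copyDesign_of_lt_two (by norm_num) s.u)
    refine ⟨s', hs', ?_⟩
    have hc : RescaledCopy S 1 2 (s'.u (S.τ 1)) (s'.u (S.τ 2)) (2 / 3) := hD' le_rfl
    rw [(hs' (S.τ 1) ⟨(S.τ_pos 1).le, le_rfl⟩).1] at hc
    exact hc

/-- **The designed base is the base**: the copy design is empty below level `2`, so a level-`1` stage
in the design is just a registered level-`1` stage — `EpisodeBaseGM (withDesign CopyDesign (routeG
wide)) ↔ EpisodeBaseG`. [folklore] -/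
theorem episodeBaseGM_copyDesign_iff :
    EpisodeBaseGM (Margins.withDesign CopyDesign (Margins.routeG TowerRates.wide)) ↔ EpisodeBaseG := by
  rw [episodeBaseGM_withDesign_iff, ← episodeBaseGM_routeG_iff]
  constructor
  · rintro ⟨S, s, hP, hR, hQ, -⟩
    exact ⟨S, hP, hR, hQ, ⟨s⟩⟩
  · rintro ⟨S, hP, hR, hQ, ⟨s⟩⟩
    exact ⟨S, s, hP, hR, hQ, copyDesign_of_lt_two (by norm_num) s.u⟩

/-- **The designed induction is the first gate with copy output together with the gate stub**:
`EpisodeInductionGM (withDesign CopyDesign (routeG wide)) ↔ FirstGateCopy ∧ Renormalise` (levels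
`k = 1` / `k ≥ 2`). [folklore] -/
theorem episodeInductionGM_copyDesign_iff :
    EpisodeInductionGM (Margins.withDesign CopyDesign (Margins.routeG TowerRates.wide)) ↔
      FirstGateCopy ∧ Renormalise := by
  rw [episodeInductionGM_iff_forall, firstGateCopy_iff_heredityAtGM_copyDesign,
    renormalise_iff_heredityAtGM_copyDesign]
  constructor
  · intro h
    exact ⟨h 1 le_rfl, fun k hk => h k (le_trans (by norm_num) hk)⟩
  · rintro ⟨h1, h2⟩ k hk
    rcases (show k = 1 ∨ 2 ≤ k by omega) with rfl | hk2
    · exact h1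
    · exact h2 k hk2

/-- **A designed tower from the line, without `Capture`**: the registered base, the first gate with copy
output and the gate stub inhabit the interface at unit viscosity (assembly `Realisation.ofEpisodes`
over the margin `withDesign CopyDesign (routeG wide)`). Conditional on its three hypotheses; nothing
asserted. [cite: Palasek2026ElementaryModel, §4] -/
theorem nonempty_realisation_of_firstGateCopy_renormalise (hB : EpisodeBaseG) (hF : FirstGateCopy)
    (hR : Renormalise) : Nonempty (Realisation 1 TowerRates.wide) :=
  nonempty_realisation_of_episodesGM (episodeBaseGM_copyDesign_iff.2 hB)
    (episodeInductionGM_copyDesign_iff.2 ⟨hF, hR⟩)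

/-- **Fefferman's (C) from the line WITHOUT the stub `Capture`** (the honest `∃ design, ∀ stage in the
design` route of planner RULING l.1890 (1), for the `2/3`-rescaled-copy design, by name):
`EpisodeBaseG → FirstGateCopy → Renormalise → W14 → NavierStokesBreakdownR3`, W14 being the
Literature named fact `tao2011_forced_unconditionalUniqueness_velocity` (the route's support item;
UNPROVED, hypothesis). Conditional on all four; none is asserted. [cite: FeffermanClay2006, (C)] -/
theorem navierStokesBreakdownR3_of_firstGateCopy_renormalise (hB : EpisodeBaseG) (hF : FirstGateCopy)
    (hR : Renormalise) (hU : tao2011_forced_unconditionalUniqueness_velocity) :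
    Summit.NavierStokesRegularity.NavierStokesRegularity.NavierStokesBreakdownR3 :=
  navierStokesBreakdownR3_of_designed (episodeBaseGM_copyDesign_iff.2 hB)
    (episodeInductionGM_copyDesign_iff.2 ⟨hF, hR⟩) hU

/-! ## §2 The line is lossless modulo `Capture` -/

/-- **Capture + the gate ⇒ heredity from level `2`** (the line's composition at the generic levels,
against the tree's child decl): the gate, fed the stage's own copy clause, returns a continuation that
runs and carries the next letter, i.e. an extension stage. [folklore] -/
theorem heredityFrom_two_of_capture_renormalise (hC : Capture) (hR : Renormalise) : HeredityFrom 2 := by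
  intro S hP hRig hQ k hk s
  obtain ⟨u, p, hrun, hlet, -⟩ := hR S hP hRig hQ k hk s (hC S hP hRig hQ k hk s)
  exact s.exists_extends_iff_runs_letter.2 ⟨u, p, hrun, hlet⟩

/-- **Heredity from level `2` + Capture ⇒ the gate**: the extension stage's own fields run and read out
a letter, and `Capture` AT LEVEL `k + 1`, applied to the extension stage, is exactly the output copy
clause (its level-`k` letter is the input letter by the agreement at `τ k`). [folklore] -/
theorem Renormalise.of_heredityFrom_two (h : HeredityFrom 2) (hC : Capture) : Renormalise := by
  intro S hP hR hQ k hk s _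
  obtain ⟨s', hs'⟩ := h S hP hR hQ k hk s
  refine ⟨s'.u, s'.p, Runs.of_extends s s' hs', Letter.of_stage s' le_rfl, ?_⟩
  have hc := hC S hP hR hQ (k + 1) (le_trans hk (Nat.le_succ k)) s'
  rw [Nat.add_sub_cancel, (hs' (S.τ k) ⟨(S.τ_pos k).le, le_rfl⟩).1] at hc
  exact hc

/-- **Given alphabet closure, the gate stub IS the child crux `HeredityFrom 2`.** [folklore] -/
theorem renormalise_iff_heredityFrom_two (hC : Capture) : Renormalise ↔ HeredityFrom 2 :=
  ⟨heredityFrom_two_of_capture_renormalise hC, fun h => Renormalise.of_heredityFrom_two h hC⟩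

/-- **The line's composition against the landed register**: first gate (= `HeredityAtOne`, item -19249)
+ Capture + the gate ⇒ K2G `EpisodeInductionG` (through the lossless split of p415576). [folklore] -/
theorem episodeInductionG_of_heredityAtOne_capture_renormalise (h₁ : HeredityAtOne) (hC : Capture)
    (hR : Renormalise) : EpisodeInductionG :=
  episodeInductionG_iff_heredityAtOne_and_heredityFrom_two.2
    ⟨h₁, heredityFrom_two_of_capture_renormalise hC hR⟩

/-- **Given alphabet closure the line is LOSSLESS**: `EpisodeInductionG ↔ HeredityAtOne ∧ Renormalise`.
[folklore] -/
theorem episodeInductionG_iff_heredityAtOne_and_renormalise (hC : Capture) :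
    EpisodeInductionG ↔ HeredityAtOne ∧ Renormalise := by
  rw [episodeInductionG_iff_heredityAtOne_and_heredityFrom_two, renormalise_iff_heredityFrom_two hC]

/-- In particular the crux itself yields the gate stub, given alphabet closure. [folklore] -/
theorem EpisodeInductionG.renormalise (h : EpisodeInductionG) (hC : Capture) : Renormalise :=
  Renormalise.of_heredityFrom_two (h.heredityFrom (by norm_num)) hC

/-! ## §3 Propagation: given the gate, `Capture` is its first instance -/

/-- **One step of propagation.** Given the gate stub, capture at level `k ≥ 2` implies capture at level
`k + 1`: a registered stage `s` at level `k + 1` restricts to level `k` (`Stage.restrictOfAntitone`,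
the route margin is antitone), the restriction is in the copy design by `CaptureAt k`, the gate returns a
finite-energy classical continuation `u` to `τ (k+1)` whose readout is a `2/3`-copy of the level-`k`
letter, and `u = s.u` on `[0, τ (k+1)]` by silent-window uniqueness (`Stage.continuation_velocity_eq`:
the schedule is quiet and `k ≥ 2`; no named fact) — so the copy clause is a clause of `s`.
[cite: Tao2011, Cor. 11.4] -/
theorem CaptureAt.succ {k : ℕ} (h : CaptureAt k) (hR : Renormalise) (hk : 2 ≤ k) :
    CaptureAt (k + 1) := by
  intro S hP hRig hQ s
  let s₀ : Stage 1 TowerRates.wide S (Margins.routeG TowerRates.wide) k :=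
    s.restrictOfAntitone (Margins.antitone_routeG TowerRates.wide) (Nat.le_succ k)
  obtain ⟨u, p, ⟨hcl, hagree, henergy, -⟩, -, hcopy⟩ := hR S hP hRig hQ k hk s₀ (h S hP hRig hQ s₀)
  have heq : ∀ t ∈ Icc 0 (S.τ (k + 1)), u t = s.u t :=
    s₀.continuation_velocity_eq one_pos hQ hk (S.τ_mono (Nat.le_succ k)) hcl s.classical
      (fun t ht => (hagree t ht).1) (fun _ _ => rfl) henergy s.energy
  rw [Nat.add_sub_cancel, ← heq (S.τ (k + 1)) ⟨(S.τ_pos _).le, le_rfl⟩]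
  exact hcopy

/-- Propagation through a range of levels: given the gate, capture at a level `k₀ ≥ 2` implies capture
at every later level. [cite: Tao2011, Cor. 11.4] -/
theorem CaptureAt.of_le {k₀ k : ℕ} (h : CaptureAt k₀) (hR : Renormalise) (hk₀ : 2 ≤ k₀)
    (hk : k₀ ≤ k) : CaptureAt k := by
  induction k, hk using Nat.le_induction with
  | base => exact h
  | succ k hle ih => exact ih.succ hR (hk₀.trans hle)

/-- **Given the gate, `Capture` follows from its first instance `CaptureAt 2`.** [cite: Tao2011, Cor. 11.4] -/
theorem capture_of_captureAt_two (h₂ : CaptureAt 2) (hR : Renormalise) : Capture :=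
  capture_iff_forall_captureAt.2 fun _ hk => h₂.of_le hR le_rfl hk

/-- **Given the gate, `Capture ↔ CaptureAt 2`** — the line's ∀-level «most killable» stub is, modulo
its load-bearing stub, a statement about level-`2` stages only. [cite: Tao2011, Cor. 11.4] -/
theorem capture_iff_captureAt_two (hR : Renormalise) : Capture ↔ CaptureAt 2 :=
  ⟨fun h => h.captureAt le_rfl, fun h => capture_of_captureAt_two h hR⟩

/-- **The registered stub set closes the crux with `stub_capture` weakened to its first instance**:
`HeredityAtOne → CaptureAt 2 → Renormalise → EpisodeInductionG`. [folklore] -/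
theorem episodeInductionG_of_heredityAtOne_captureAtTwo_renormalise (h₁ : HeredityAtOne)
    (h₂ : CaptureAt 2) (hR : Renormalise) : EpisodeInductionG :=
  episodeInductionG_of_heredityAtOne_capture_renormalise h₁ (capture_of_captureAt_two h₂ hR) hR

/-! ## §4 The `k = 1` corner: the first gate with copy output -/

/-- The first gate with copy output contains the first gate (`HeredityAtOne`, item -19249). [folklore] -/
theorem FirstGateCopy.heredityAtOne (h : FirstGateCopy) : HeredityAtOne :=
  fun S hP hR hQ s => by
    obtain ⟨s', hs', -⟩ := h S hP hR hQ s
    exact ⟨s', hs'⟩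

/-- **`FirstGateCopy → W14 → CaptureAt 2`.** Every registered level-`2` stage `s` restricts to level
`1`; the first gate with copy output extends the restriction to SOME level-`2` stage `s'` whose
level-`2` letter is a copy; and `s'.u = s.u` on `[0, τ 2]` because two stages of one schedule share
their velocity given Tao's FORCED unconditional uniqueness (`Stage.velocity_eq_of_le`; the comparison
runs from the Clay datum across the forced stretch `[0, τ₁)`, so the unforced tree theorem does not
apply at this corner). [cite: Tao2011, Cor. 11.4] -/
theorem FirstGateCopy.captureAt_two (h : FirstGateCopy)
    (hU : tao_unconditional_uniqueness_velocity_forced) : CaptureAt 2 := by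
  intro S hP hR hQ s
  let s₀ : Stage 1 TowerRates.wide S (Margins.routeG TowerRates.wide) 1 :=
    s.restrictOfAntitone (Margins.antitone_routeG TowerRates.wide) (Nat.le_succ 1)
  obtain ⟨s', -, hc⟩ := h S hP hR hQ s₀
  have heq : ∀ t ∈ Icc 0 (S.τ 2), s'.u t = s.u t := Stage.velocity_eq_of_le hU one_pos le_rfl s s'
  show RescaledCopy S 1 2 (s.u (S.τ 1)) (s.u (S.τ 2)) (2 / 3)
  rw [← heq (S.τ 2) ⟨(S.τ_pos 2).le, le_rfl⟩]
  exact hc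

/-- Conversely (no uniqueness needed): the first gate and capture at level `2` give the first gate with
copy output — read `CaptureAt 2` on the extension stage. [folklore] -/
theorem firstGateCopy_of_heredityAtOne_captureAt_two (h₁ : HeredityAtOne) (h₂ : CaptureAt 2) :
    FirstGateCopy := by
  intro S hP hR hQ s
  obtain ⟨s', hs'⟩ := h₁ S hP hR hQ s
  refine ⟨s', hs', ?_⟩
  have hc : RescaledCopy S 1 2 (s'.u (S.τ 1)) (s'.u (S.τ 2)) (2 / 3) := h₂ S hP hR hQ s'
  rw [(hs' (S.τ 1) ⟨(S.τ_pos 1).le, le_rfl⟩).1] at hc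
  exact hc

/-- **Given W14, `FirstGateCopy ↔ HeredityAtOne ∧ CaptureAt 2`.** [cite: Tao2011, Cor. 11.4] -/
theorem firstGateCopy_iff (hU : tao_unconditional_uniqueness_velocity_forced) :
    FirstGateCopy ↔ HeredityAtOne ∧ CaptureAt 2 :=
  ⟨fun h => ⟨h.heredityAtOne, h.captureAt_two hU⟩,
    fun h => firstGateCopy_of_heredityAtOne_captureAt_two h.1 h.2⟩

/-- **The crux ITEM from the two designed statements, modulo the route's uniqueness item**:
`FirstGateCopy → Renormalise → W14 → EpisodeInductionG` (W14 in the bridge's spelling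
`tao_unconditional_uniqueness_velocity_forced`). [cite: Tao2011, Cor. 11.4] -/
theorem episodeInductionG_of_firstGateCopy_renormalise (hF : FirstGateCopy) (hR : Renormalise)
    (hU : tao_unconditional_uniqueness_velocity_forced) : EpisodeInductionG :=
  episodeInductionG_of_heredityAtOne_captureAtTwo_renormalise hF.heredityAtOne (hF.captureAt_two hU) hR

/-- The same with W14 in the Literature spelling of the route's support item
(`tao2011_forced_unconditionalUniqueness_velocity`, fed through `.schwartzForce`). [cite: Tao2011, Cor. 11.4] -/
theorem episodeInductionG_of_firstGateCopy_renormalise' (hF : FirstGateCopy) (hR : Renormalise)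
    (hU : tao2011_forced_unconditionalUniqueness_velocity) : EpisodeInductionG :=
  episodeInductionG_of_firstGateCopy_renormalise hF hR
    (tao2011_forced_unconditionalUniqueness_velocity.schwartzForce hU)

/-- **Summary, given W14: the crux WITH alphabet closure is exactly the designed pair** —
`EpisodeInductionG ∧ Capture ↔ FirstGateCopy ∧ Renormalise` (⇒ needs no uniqueness; ⇐ uses the
forced fact at the `k = 1` corner and the unforced tree theorem above it). [cite: Tao2011, Cor. 11.4] -/
theorem episodeInductionG_and_capture_iff (hU : tao_unconditional_uniqueness_velocity_forced) :
    EpisodeInductionG ∧ Capture ↔ FirstGateCopy ∧ Renormalise := by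
  constructor
  · rintro ⟨hE, hC⟩
    exact ⟨firstGateCopy_of_heredityAtOne_captureAt_two hE.heredityAtOne (hC.captureAt le_rfl),
      hE.renormalise hC⟩
  · rintro ⟨hF, hR⟩
    exact ⟨episodeInductionG_of_firstGateCopy_renormalise hF hR hU,
      capture_of_captureAt_two (hF.captureAt_two hU) hR⟩

/-- … and WITHOUT any uniqueness fact the designed pair is exactly the designed induction of p420640
(restated from §1 next to the summary for comparison): what the line adds to the crux is the design,
what the crux adds to the designed pair is nothing but W14 at the first corner. [folklore] -/
theorem firstGateCopy_and_renormalise_iff :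
    FirstGateCopy ∧ Renormalise ↔
      EpisodeInductionGM (Margins.withDesign CopyDesign (Margins.routeG TowerRates.wide)) :=
  episodeInductionGM_copyDesign_iff.symm

end Summit.NavierStokesRegularity.FluidComputer.PalasekTowerClayBridge

end
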